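import Summits.QuantumFields.YangMills.Theorems.GronwallGapContinuumFromLatticeGapSlabBoxSupport
import HarnessLib

/-!
# `ContinuumFromLatticeGap` (stmt-QuantumFields-15915), line `registered`, reshape 5: `stub_decayOfRPSpectralLocal` —
# the decay leg of the one-field clauses from the LOCAL RP-spectral class

Support file for the crux item stmt-QuantumFields-15915 (`GronwallGap.ContinuumFromLatticeGap`), reshape 5 of line
`registered` (conjunct (b) of `IRInputs` / W₁ over the LOCAL class: slab functionals depending only on edges `e` with
`1 ≤ e⁰`, `e⁰ + [μ = 0] ≤ T₀`, `|eⁱ| ≤ R` (`i ≠ 0`) on tori `2S₀+1` with `2(R+1) ≤ S₀`).  It re-proves the ONLY consumer of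
(b) in the landed existence leg — the decay clause `Decay (planeSum T) Δ` (`stub_decayOfRPSpectral`, crux 16120 r10) — from
the local form: the smeared functional `Y_k` of a test function supported in the closed ball of radius `ρ` lives in the
spatial box of half-side `⌊ρ/a_k⌋ + 2` (`slabBox_support` + the toolkit `curvFunctional_dependsOn_slabBox`), admissible on
the scheme's torus once `2(⌊ρ/a_k⌋ + 3) ≤ L_k`, i.e. eventually.  Everything else is verbatim the landed proof.  No
definitions, no named facts.  Refs: OsterwalderSeiler1978 §§2–3; GlimmJaffe1987 §6.1, §19.7.
-/

noncomputable section

open scoped SchwartzMap BigOperators ComplexConjugate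
open MeasureTheory Filter Topology
open Literature.MathematicalPhysics.QuantumFieldTheory Literature.MathematicalPhysics.QuantumLattice
open Literature.MathematicalPhysics.AQFT
open Literature.Probability.LatticeModels (box Site mem_box)
open Summit.QuantumFields.YangMills.Cruxes.HypercubicLimit.CouplingResponse
open Summit.QuantumFields.YangMills.Cruxes.OSLegsFromFemtoAndGap.DlrCollarTransfer (plane conn Decay)
open Summit.QuantumFields.YangMills.Cruxes.OSLegsAtWeakCouplingC.Sketch (Separated)
open Summit.QuantumFields.YangMills.Theorems.OSLegsFromFemtoAndGap
open Summit.QuantumFields.YangMills.Theorems.WeakCouplingHypercubicLimit.TraceNormColdPressure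

namespace Summit.QuantumFields.YangMills.Theorems.ContinuumFromLatticeGap

variable {G : Type} [Group G] [TopologicalSpace G] [IsTopologicalGroup G] [CompactSpace G]
  [MeasurableSpace G] [BorelSpace G]

section Main2

variable (r : LatticeRep G) (sch : SpeciesScheme (YMSpecies G)) (φ : ℕ → ℕ) (hφ : StrictMono φ)
  (T : (n : ℕ) → (Fin n → Plane) → (𝓢((Fin n → EuclideanSpace ℝ (Fin 4)), ℂ) →L[ℂ] ℂ))
  (hUFB : UniformFunctionalBoundPlanes r sch) (hPL : PlaneLimits r sch φ T)
  {n : ℕ} {F : 𝓢((Fin n → EuclideanSpace ℝ (Fin 4)), ℂ)} {ρ τ δ : ℝ} (hτ : 0 < τ) (hδ : 0 < δ) (hρ : 0 ≤ ρ)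
  (hFρ : tsupport (F : (Fin n → EuclideanSpace ℝ (Fin 4)) → ℂ) ⊆ Metric.closedBall 0 ρ)
  (hFτ : tsupport (F : (Fin n → EuclideanSpace ℝ (Fin 4)) → ℂ) ⊆ {u | ∀ l, τ ≤ u l 0})
  (hFδ : tsupport (F : (Fin n → EuclideanSpace ℝ (Fin 4)) → ℂ) ⊆ Separated n δ)
  (hFr : ∀ u, conj (F u) = F u)

include hFρ in
/-- **Spatial box support**: the smeared renormalised functional of a test function supported in the closed ball of
radius `ρ` only sees lattice multi-points with `|y_lⁱ| + 1 ≤ ⌊ρ/a⌋ + 2`. [folklore] -/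
theorem slabBox_support (k : ℕ) :
    ∀ y : Fin n → Site 4,
      ((((sch.c r.curvature (φ k) * sch.a (φ k) ^ 4) ^ n : ℝ) : ℂ) • F) (fun l => sch.a (φ k) • siteToE (y l)) ≠ 0 →
        ∀ l, ∀ i : Fin 4, i ≠ 0 → |y l i| + 1 ≤ ((⌊ρ / sch.a (φ k)⌋₊ + 2 : ℕ) : ℤ) := by
  intro y hy l i _
  have ha := sch.a_pos (φ k)
  have hy' : F (fun l => sch.a (φ k) • siteToE (y l)) ≠ 0 := by
    intro h; apply hy
    show (_ : ℂ) • F (fun l => sch.a (φ k) • siteToE (y l)) = 0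
    rw [h, smul_zero]
  have hbox := thermal_bookkeeping_mem_piFinset_box F ha hFρ hy'
  rw [Fintype.mem_piFinset] at hbox
  have hl := (mem_box.1 (hbox l)) i
  have habs : |y l i| ≤ (⌊ρ / sch.a (φ k)⌋₊ : ℤ) := abs_le.2 ⟨hl.1, hl.2⟩
  push_cast
  omega

include hφ hUFB hPL hτ hδ hρ hFρ hFτ hFδ hFr

/-- **The decay inequality on the separated class, from LOCAL RP-spectral clustering.**  From relative clustering of
reflected slab functionals supported in a spatial box of half-side `R` with `2(R+1) ≤ S₀` (the local class), polynomial
volume growth and renormalisation and a bounded counterterm: for a real test function supported at `δ`-separated points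
with times in `[τ, ρ]` and every `t ≥ 0`, `Re conn(F, T_t F) ≤ Re conn(F, F) · e^{−Δt}` for the candidate family
`planeSum T` (proof of `decay_separated`; new input: `Y_k` lives in the spatial box of half-side `⌊ρ/a⌋ + 2`).
-- adapted from Theorems/PencilRigidityWeakCouplingHypercubicLimitDecayOfRPSpectral.lean [folklore] -/
theorem decay_separated_local (hpv : PolyVolume sch) (hpr : PolyRenorm r sch) (hbm : ∃ Cm : ℝ, ∀ k, |sch.m r.curvature k| ≤ Cm)
    {Δ C : ℝ} (hΔ : 0 < Δ)
    (hrp : (∀ᶠ k in atTop, ∀ (S₀ T₀ n R : ℕ), sch.L k ≤ S₀ → 2 * (T₀ + n + 1) ≤ S₀ → 2 * (R + 1) ≤ S₀ →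
        ∀ (Y : LGConfig 4 G → ℝ) (B : ℝ), Measurable Y → (∀ U, |Y U| ≤ B) →
          DependsOn Y {e : Literature.MathematicalPhysics.QuantumLattice.ZdEdge 4 |
            (1 ≤ e.1 0 ∧ e.1 0 + (if e.2 = 0 then 1 else 0) ≤ T₀) ∧ ∀ i : Fin 4, i ≠ 0 → |e.1 i| ≤ R} →
          |(∫ U, Y (torusLift (2 * S₀ + 1) (GaugeConfig.timeReflect U)) *
                Y (configShift (-Pi.single 0 (n : ℤ)) (torusLift (2 * S₀ + 1) U))
              ∂(wilsonMeasure r.ρ (sch.β k) : Measure (GaugeConfig 4 (2 * S₀ + 1) G))) -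
            (∫ U, Y (torusLift (2 * S₀ + 1) U)
              ∂(wilsonMeasure r.ρ (sch.β k) : Measure (GaugeConfig 4 (2 * S₀ + 1) G))) ^ 2| ≤
            Real.exp (-(Δ * sch.a k * n)) *
              ((∫ U, Y (torusLift (2 * S₀ + 1) (GaugeConfig.timeReflect U)) * Y (torusLift (2 * S₀ + 1) U)
                  ∂(wilsonMeasure r.ρ (sch.β k) : Measure (GaugeConfig 4 (2 * S₀ + 1) G))) -
                (∫ U, Y (torusLift (2 * S₀ + 1) U)
                  ∂(wilsonMeasure r.ρ (sch.β k) : Measure (GaugeConfig 4 (2 * S₀ + 1) G))) ^ 2) +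
            C * B ^ 2 * Real.exp (-(Δ * sch.a k * S₀))))
    {t : ℝ} (ht : 0 ≤ t) :
    (conn (planeSum T) F (translateMulti (EuclideanSpace.single (0 : Fin 4) t) F)).re ≤
      (conn (planeSum T) F F).re * Real.exp (-(Δ * t)) := by
  classical
  obtain ⟨Cp, hCp0, hfacts⟩ := curvFunctional_facts G r
  obtain ⟨Cm, hCm⟩ := hbm
  obtain ⟨Qr, hQr⟩ := hpr
  have hCm0 : 0 ≤ Cm := (abs_nonneg _).trans (hCm 0)
  have hFps := posSep_of_separated hδ hτ hFδ hFτ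
  have hFo : IsOffDiagonal F := isOffDiagonal_of_posSep hFps
  -- lattice times and translation vectors
  have ha0 : Tendsto (fun k => sch.a (φ k)) atTop (𝓝 0) := sch.tendsto_a.comp hφ.tendsto_atTop
  have haL : Tendsto (fun k => sch.a (φ k) * sch.L (φ k)) atTop atTop := sch.tendsto_L.comp hφ.tendsto_atTop
  obtain ⟨hjb, hcoef⟩ := latticeTime_facts ht (fun k => sch.a_pos (φ k)) ha0
  set jj : ℕ → ℕ := fun k => ⌊t / (2 * sch.a (φ k))⌋₊ with hjj
  set vv : ℕ → EuclideanSpace ℝ (Fin 4) := fun k =>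
    ((((2 * jj k : ℕ) : ℝ) * sch.a (φ k)) • EuclideanSpace.single (0 : Fin 4) (1 : ℝ)) with hvv
  have hvv_lim : Tendsto vv atTop (𝓝 (EuclideanSpace.single (0 : Fin 4) t)) := by
    have h := hcoef.smul_const (EuclideanSpace.single (0 : Fin 4) (1 : ℝ))
    rwa [smul_single_one_eq] at h
  have hvv0 : ∀ k, 0 ≤ vv k 0 := fun k => by
    have h1 : vv k 0 = ((2 * jj k : ℕ) : ℝ) * sch.a (φ k) := by simp [hvv]
    rw [h1]; exact mul_nonneg (Nat.cast_nonneg _) (sch.a_pos (φ k)).le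
  -- the renormalised test functions are real
  have hFkr : ∀ k x, conj (((((sch.c r.curvature (φ k) * sch.a (φ k) ^ 4) ^ n : ℝ) : ℂ) • F) x) =
      ((((sch.c r.curvature (φ k) * sch.a (φ k) ^ 4) ^ n : ℝ) : ℂ) • F) x := fun k x => by
    show conj ((_ : ℂ) • F x) = (_ : ℂ) • F x
    rw [smul_eq_mul, map_mul, Complex.conj_ofReal, hFr x]
  -- the three continuum quantities as limits of lattice pairings (toolkit A)
  have hP2 := tendsto_rpPair r sch φ hφ T hUFB hPL hτ hδ hFρ hFτ hFδ F hFps vv _ hvv_lim hvv0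
  have hP0 := tendsto_rpPair r sch φ hφ T hUFB hPL hτ hδ hFρ hFτ hFδ F hFps (fun _ => 0) 0 tendsto_const_nhds
    (fun _ => le_rfl)
  simp only [translateMulti_zero_eq] at hP0
  have hP1 := tendsto_mean r sch φ T hPL hτ hδ hFτ hFδ
  -- identities of the limit family on this class
  have hherm := planeSum_osAdjoint_eq_conj r sch φ hφ T hUFB hPL hτ hδ hFρ hFτ hFδ
  have hreal := conj_planeSum_eq r sch φ T hPL hτ hδ hFτ hFδ hFr
  have htrans := planeSum_translate_eq r sch φ hφ T hUFB hPL hτ hδ hρ hFρ hFτ hFδ ht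
  -- the real lattice functional `Y k` and its facts (toolkit SG-A)
  obtain ⟨Y, hY⟩ : ∃ Y : ℕ → LGConfig 4 G → ℝ, Y = fun k V =>
      (∑ q ∈ Fintype.piFinset (fun _ : Fin n => Finset.univ.filter fun p : Fin 4 × Fin 4 => p.1 < p.2),
        ∑ y ∈ Fintype.piFinset (fun _ : Fin n => box 4 (sch.L (φ k))),
          ((((sch.c r.curvature (φ k) * sch.a (φ k) ^ 4) ^ n : ℝ) : ℂ) • F) (fun l => sch.a (φ k) • siteToE (y l)) *
            ((∏ l, (plane G r (q l) (y l) V - sch.m r.curvature (φ k) / 6) : ℝ) : ℂ)).re := ⟨_, rfl⟩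
  have hm6 : ∀ k, ∀ q : Fin 4 × Fin 4, |(fun _ : Fin 4 × Fin 4 => sch.m r.curvature (φ k) / 6) q| ≤ Cm / 6 := by
    intro k q
    show |sch.m r.curvature (φ k) / 6| ≤ Cm / 6
    rw [abs_div, abs_of_pos (by norm_num : (0:ℝ) < 6)]
    exact div_le_div_of_nonneg_right (hCm _) (by norm_num)
  have hYm : ∀ k, Measurable (Y k) := fun k => by
    rw [hY]; exact (hfacts (sch.L (φ k)) (sch.a (φ k)) n _ _ _ (hm6 k)).1
  have hYb : ∀ k V, |Y k V| ≤ (6 * (Cp + Cm / 6)) ^ n *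
      ∑ y ∈ Fintype.piFinset (fun _ : Fin n => box 4 (sch.L (φ k))),
        ‖((((sch.c r.curvature (φ k) * sch.a (φ k) ^ 4) ^ n : ℝ) : ℂ) • F) (fun l => sch.a (φ k) • siteToE (y l))‖ :=
    fun k V => by rw [hY]; exact (hfacts (sch.L (φ k)) (sch.a (φ k)) n _ _ _ (hm6 k)).2.1 V
  have hYd : ∀ k, DependsOn (Y k) {e : Literature.MathematicalPhysics.QuantumLattice.ZdEdge 4 |
      1 ≤ e.1 0 ∧ e.1 0 + (if e.2 = 0 then 1 else 0) ≤ ((⌊ρ / sch.a (φ k)⌋₊ + 2 : ℕ) : ℤ)} := fun k => by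
    rw [hY]
    exact (hfacts (sch.L (φ k)) (sch.a (φ k)) n _ _ _ (hm6 k)).2.2 _ (slab_support r sch φ hτ hFρ hFτ k)
  have hYR : ∀ k, DependsOn (Y k) {e : Literature.MathematicalPhysics.QuantumLattice.ZdEdge 4 |
      (1 ≤ e.1 0 ∧ e.1 0 + (if e.2 = 0 then 1 else 0) ≤ ((⌊ρ / sch.a (φ k)⌋₊ + 2 : ℕ) : ℤ)) ∧
        ∀ i : Fin 4, i ≠ 0 → |e.1 i| ≤ ((⌊ρ / sch.a (φ k)⌋₊ + 2 : ℕ) : ℤ)} := fun k => by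
    rw [hY]
    exact curvFunctional_dependsOn_slabBox r (sch.L (φ k)) (sch.a (φ k)) n
      ((((sch.c r.curvature (φ k) * sch.a (φ k) ^ 4) ^ n : ℝ) : ℂ) • F) (fun _ => sch.m r.curvature (φ k) / 6)
      (⌊ρ / sch.a (φ k)⌋₊ + 2) (⌊ρ / sch.a (φ k)⌋₊ + 2)
      (slab_support r sch φ hτ hFρ hFτ k) (slabBox_support r sch φ hFρ k)
  -- the smeared field is the real functional read through the lift
  have hYf : ∀ k (U : GaugeConfig 4 (2 * sch.L (φ k) + 1) G),
      fieldObs r (sch.L (φ k)) (sch.a (φ k)) ((((sch.c r.curvature (φ k) * sch.a (φ k) ^ 4) ^ n : ℝ) : ℂ) • F)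
        (fun _ => sch.m r.curvature (φ k) / 6) U = ((Y k (torusLift (2 * sch.L (φ k) + 1) U) : ℝ) : ℂ) := by
    intro k U
    have hre := Complex.conj_eq_iff_re.1 (conj_fieldObs r (sch.L (φ k)) (sch.a (φ k)) _
      (fun _ => sch.m r.curvature (φ k) / 6) (hFkr k) U)
    rw [← hre, hY]
    rfl
  -- an explicit polynomial bound of the functional
  set K₁ : ℝ := (6 * (Cp + Cm / 6)) ^ n * ((2 * ρ + 3) ^ (4 * n) * SchwartzMap.seminorm ℂ 0 0 F) with hK₁
  have hK₁0 : 0 ≤ K₁ := by positivity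
  have hYB : ∀ k, sch.a (φ k) ≤ 1 → ∀ V, |Y k V| ≤ K₁ * ((sch.a (φ k))⁻¹ ^ Qr) ^ n := by
    intro k hak V
    have ha := sch.a_pos (φ k)
    refine (hYb k V).trans ?_
    have hsupp : tsupport (((((sch.c r.curvature (φ k) * sch.a (φ k) ^ 4) ^ n : ℝ) : ℂ) • F :
        𝓢((Fin n → EuclideanSpace ℝ (Fin 4)), ℂ)) : (Fin n → EuclideanSpace ℝ (Fin 4)) → ℂ) ⊆ Metric.closedBall 0 ρ := by
      have hfun : (((((sch.c r.curvature (φ k) * sch.a (φ k) ^ 4) ^ n : ℝ) : ℂ) • F :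
          𝓢((Fin n → EuclideanSpace ℝ (Fin 4)), ℂ)) : (Fin n → EuclideanSpace ℝ (Fin 4)) → ℂ) =
          fun u => ((((sch.c r.curvature (φ k) * sch.a (φ k) ^ 4) ^ n : ℝ) : ℂ)) * F u := rfl
      rw [hfun]
      exact (tsupport_mul_subset_right (f := fun _ => ((((sch.c r.curvature (φ k) * sch.a (φ k) ^ 4) ^ n : ℝ) : ℂ)))
        (g := (F : (Fin n → EuclideanSpace ℝ (Fin 4)) → ℂ))).trans hFρ
    have hsum := thermal_bookkeeping_sum_le n _ ρ (sch.a (φ k)) (sch.L (φ k)) ha hρ hsupp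
    rw [map_smul_eq_mul, Complex.norm_real, Real.norm_eq_abs, abs_pow, abs_mul, abs_pow,
      abs_of_pos ha] at hsum
    refine (mul_le_mul_of_nonneg_left hsum (by positivity)).trans ?_
    -- `(2ρ/a+3)^{4n} a^{4n} = (2ρ+3a)^{4n} ≤ (2ρ+3)^{4n}` and `|c|^n ≤ a^{-Qr n}`
    have h1 : (2 * ρ / sch.a (φ k) + 3) ^ (4 * n) * (sch.a (φ k) ^ 4) ^ n ≤ (2 * ρ + 3) ^ (4 * n) := by
      rw [show (sch.a (φ k) ^ 4) ^ n = sch.a (φ k) ^ (4 * n) by ring, ← mul_pow]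
      apply pow_le_pow_left₀ (by positivity)
      rw [add_mul, div_mul_cancel₀ _ ha.ne']
      nlinarith
    have h2 : |sch.c r.curvature (φ k)| ^ n ≤ ((sch.a (φ k))⁻¹ ^ Qr) ^ n :=
      pow_le_pow_left₀ (abs_nonneg _) (hQr _) n
    have h3 : 0 ≤ SchwartzMap.seminorm ℂ 0 0 F := apply_nonneg _ _
    calc (6 * (Cp + Cm / 6)) ^ n * ((2 * ρ / sch.a (φ k) + 3) ^ (4 * n) *
          ((|sch.c r.curvature (φ k)| * sch.a (φ k) ^ 4) ^ n * SchwartzMap.seminorm ℂ 0 0 F))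
        = (6 * (Cp + Cm / 6)) ^ n * (((2 * ρ / sch.a (φ k) + 3) ^ (4 * n) * (sch.a (φ k) ^ 4) ^ n) *
            SchwartzMap.seminorm ℂ 0 0 F * |sch.c r.curvature (φ k)| ^ n) := by ring
      _ ≤ (6 * (Cp + Cm / 6)) ^ n * ((2 * ρ + 3) ^ (4 * n) * SchwartzMap.seminorm ℂ 0 0 F *
            ((sch.a (φ k))⁻¹ ^ Qr) ^ n) := by
          apply mul_le_mul_of_nonneg_left _ (by positivity)
          exact mul_le_mul (mul_le_mul_of_nonneg_right h1 h3) h2 (by positivity) (by positivity)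
      _ = K₁ * ((sch.a (φ k))⁻¹ ^ Qr) ^ n := by rw [hK₁]; ring
  -- eventual geometric conditions
  have ha1 : ∀ᶠ k in atTop, sch.a (φ k) ≤ 1 := (ha0.eventually (ge_mem_nhds one_pos))
  have hgeom : ∀ᶠ k in atTop, 2 * ((⌊ρ / sch.a (φ k)⌋₊ + 2) + 2 * jj k + 1) ≤ sch.L (φ k) := by
    filter_upwards [haL.eventually (eventually_ge_atTop (2 * ρ + 2 * t + 6)), ha1] with k hk hak
    have ha := sch.a_pos (φ k)
    have hfl : ((⌊ρ / sch.a (φ k)⌋₊ : ℕ) : ℝ) ≤ ρ / sch.a (φ k) := Nat.floor_le (by positivity)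
    have hj : ((2 * jj k : ℕ) : ℝ) * sch.a (φ k) ≤ t := (hjb k).2
    have h1 : (⌊ρ / sch.a (φ k)⌋₊ : ℝ) * sch.a (φ k) ≤ ρ := by
      have := mul_le_mul_of_nonneg_right hfl ha.le
      rwa [div_mul_cancel₀ _ ha.ne'] at this
    have h2 : (jj k : ℝ) * sch.a (φ k) * 2 ≤ t := by push_cast at hj; linarith
    have hreal : ((2 * ((⌊ρ / sch.a (φ k)⌋₊ + 2) + 2 * jj k + 1) : ℕ) : ℝ) * sch.a (φ k) ≤ (sch.L (φ k) : ℝ) * sch.a (φ k) := by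
      push_cast
      nlinarith [h1, h2, hk, hak, ha.le]
    have h := le_of_mul_le_mul_right hreal ha
    exact_mod_cast h
  have hbox := box_margin r sch φ hφ hρ hFρ ht
  have hrpφ := hφ.tendsto_atTop.eventually hrp
  -- the lattice inequality, eventually, in terms of the complex pairings
  have hineq : ∀ᶠ k in atTop,
      (∫ U, conj (fieldObs r (sch.L (φ k)) (sch.a (φ k))
            ((((sch.c r.curvature (φ k) * sch.a (φ k) ^ 4) ^ n : ℝ) : ℂ) • F) (fun _ => sch.m r.curvature (φ k) / 6)
            (GaugeConfig.timeReflect U)) *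
          fieldObs r (sch.L (φ k)) (sch.a (φ k))
            ((((sch.c r.curvature (φ k) * sch.a (φ k) ^ 4) ^ n : ℝ) : ℂ) • translateMulti (vv k) F)
            (fun _ => sch.m r.curvature (φ k) / 6) U
        ∂(wilsonMeasure r.ρ (sch.β (φ k)) : Measure (GaugeConfig 4 (2 * sch.L (φ k) + 1) G))).re -
        (∫ U, fieldObs r (sch.L (φ k)) (sch.a (φ k))
          ((((sch.c r.curvature (φ k) * sch.a (φ k) ^ 4) ^ n : ℝ) : ℂ) • F) (fun _ => sch.m r.curvature (φ k) / 6) U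
          ∂(wilsonMeasure r.ρ (sch.β (φ k)) : Measure (GaugeConfig 4 (2 * sch.L (φ k) + 1) G))).re ^ 2 ≤
      Real.exp (-(Δ * sch.a (φ k) * ((2 * jj k : ℕ) : ℝ))) *
        ((∫ U, conj (fieldObs r (sch.L (φ k)) (sch.a (φ k))
            ((((sch.c r.curvature (φ k) * sch.a (φ k) ^ 4) ^ n : ℝ) : ℂ) • F) (fun _ => sch.m r.curvature (φ k) / 6)
            (GaugeConfig.timeReflect U)) *
          fieldObs r (sch.L (φ k)) (sch.a (φ k))
            ((((sch.c r.curvature (φ k) * sch.a (φ k) ^ 4) ^ n : ℝ) : ℂ) • F)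
            (fun _ => sch.m r.curvature (φ k) / 6) U
          ∂(wilsonMeasure r.ρ (sch.β (φ k)) : Measure (GaugeConfig 4 (2 * sch.L (φ k) + 1) G))).re -
        (∫ U, fieldObs r (sch.L (φ k)) (sch.a (φ k))
          ((((sch.c r.curvature (φ k) * sch.a (φ k) ^ 4) ^ n : ℝ) : ℂ) • F) (fun _ => sch.m r.curvature (φ k) / 6) U
          ∂(wilsonMeasure r.ρ (sch.β (φ k)) : Measure (GaugeConfig 4 (2 * sch.L (φ k) + 1) G))).re ^ 2) +
      C * (K₁ * ((sch.a (φ k))⁻¹ ^ Qr) ^ n) ^ 2 * Real.exp (-(Δ * sch.a (φ k) * (sch.L (φ k) : ℝ))) := by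
    filter_upwards [hrpφ, hgeom, hbox, ha1] with k hrpk hgk hbk hak
    have hRk : 2 * ((⌊ρ / sch.a (φ k)⌋₊ + 2) + 1) ≤ sch.L (φ k) := by omega
    have habs := hrpk (sch.L (φ k)) (⌊ρ / sch.a (φ k)⌋₊ + 2) (2 * jj k) (⌊ρ / sch.a (φ k)⌋₊ + 2) le_rfl hgk hRk (Y k)
      (K₁ * ((sch.a (φ k))⁻¹ ^ Qr) ^ n) (hYm k) (hYB k hak) (hYR k)
    -- the three real integrals are the real parts of the complex pairings
    have e1 : ∀ U : GaugeConfig 4 (2 * sch.L (φ k) + 1) G, ((Y k (torusLift (2 * sch.L (φ k) + 1) U) : ℝ) : ℂ) =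
        fieldObs r (sch.L (φ k)) (sch.a (φ k)) ((((sch.c r.curvature (φ k) * sch.a (φ k) ^ 4) ^ n : ℝ) : ℂ) • F)
          (fun _ => sch.m r.curvature (φ k) / 6) U := fun U => (hYf k U).symm
    have e2 : ∀ U : GaugeConfig 4 (2 * sch.L (φ k) + 1) G,
        ((Y k (configShift (-Pi.single 0 ((2 * jj k : ℕ) : ℤ)) (torusLift (2 * sch.L (φ k) + 1) U)) : ℝ) : ℂ) =
        fieldObs r (sch.L (φ k)) (sch.a (φ k))
          ((((sch.c r.curvature (φ k) * sch.a (φ k) ^ 4) ^ n : ℝ) : ℂ) • translateMulti (vv k) F)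
          (fun _ => sch.m r.curvature (φ k) / 6) U := by
      intro U
      rw [← torusLift_torusConfigShift_proj, e1, ← map_smul]
      exact (fieldObs_translateMulti_eq r (sch.L (φ k)) (sch.a (φ k)) (2 * jj k) _ _ hbk U).symm
    have hconj : ∀ U : GaugeConfig 4 (2 * sch.L (φ k) + 1) G,
        conj (fieldObs r (sch.L (φ k)) (sch.a (φ k)) ((((sch.c r.curvature (φ k) * sch.a (φ k) ^ 4) ^ n : ℝ) : ℂ) • F)
          (fun _ => sch.m r.curvature (φ k) / 6) U) =
        fieldObs r (sch.L (φ k)) (sch.a (φ k)) ((((sch.c r.curvature (φ k) * sch.a (φ k) ^ 4) ^ n : ℝ) : ℂ) • F)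
          (fun _ => sch.m r.curvature (φ k) / 6) U := fun U => conj_fieldObs r _ _ _ _ (hFkr k) U
    have hE2 : (∫ U, conj (fieldObs r (sch.L (φ k)) (sch.a (φ k))
            ((((sch.c r.curvature (φ k) * sch.a (φ k) ^ 4) ^ n : ℝ) : ℂ) • F) (fun _ => sch.m r.curvature (φ k) / 6)
            (GaugeConfig.timeReflect U)) *
          fieldObs r (sch.L (φ k)) (sch.a (φ k))
            ((((sch.c r.curvature (φ k) * sch.a (φ k) ^ 4) ^ n : ℝ) : ℂ) • translateMulti (vv k) F)
            (fun _ => sch.m r.curvature (φ k) / 6) U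
        ∂(wilsonMeasure r.ρ (sch.β (φ k)) : Measure (GaugeConfig 4 (2 * sch.L (φ k) + 1) G))).re =
        ∫ U, Y k (torusLift (2 * sch.L (φ k) + 1) (GaugeConfig.timeReflect U)) *
          Y k (configShift (-Pi.single 0 ((2 * jj k : ℕ) : ℤ)) (torusLift (2 * sch.L (φ k) + 1) U))
        ∂(wilsonMeasure r.ρ (sch.β (φ k)) : Measure (GaugeConfig 4 (2 * sch.L (φ k) + 1) G)) := by
      rw [← Complex.ofReal_re (∫ U, Y k (torusLift (2 * sch.L (φ k) + 1) (GaugeConfig.timeReflect U)) *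
          Y k (configShift (-Pi.single 0 ((2 * jj k : ℕ) : ℤ)) (torusLift (2 * sch.L (φ k) + 1) U))
        ∂(wilsonMeasure r.ρ (sch.β (φ k)) : Measure (GaugeConfig 4 (2 * sch.L (φ k) + 1) G))), ← integral_complex_ofReal]
      congr 1
      refine integral_congr_ae (ae_of_all _ fun U => ?_)
      dsimp only
      rw [hconj, Complex.ofReal_mul, e1, e2]
    have hE0 : (∫ U, conj (fieldObs r (sch.L (φ k)) (sch.a (φ k))
            ((((sch.c r.curvature (φ k) * sch.a (φ k) ^ 4) ^ n : ℝ) : ℂ) • F) (fun _ => sch.m r.curvature (φ k) / 6)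
            (GaugeConfig.timeReflect U)) *
          fieldObs r (sch.L (φ k)) (sch.a (φ k))
            ((((sch.c r.curvature (φ k) * sch.a (φ k) ^ 4) ^ n : ℝ) : ℂ) • F)
            (fun _ => sch.m r.curvature (φ k) / 6) U
          ∂(wilsonMeasure r.ρ (sch.β (φ k)) : Measure (GaugeConfig 4 (2 * sch.L (φ k) + 1) G))).re =
        ∫ U, Y k (torusLift (2 * sch.L (φ k) + 1) (GaugeConfig.timeReflect U)) * Y k (torusLift (2 * sch.L (φ k) + 1) U)
        ∂(wilsonMeasure r.ρ (sch.β (φ k)) : Measure (GaugeConfig 4 (2 * sch.L (φ k) + 1) G)) := by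
      rw [← Complex.ofReal_re (∫ U, Y k (torusLift (2 * sch.L (φ k) + 1) (GaugeConfig.timeReflect U)) *
          Y k (torusLift (2 * sch.L (φ k) + 1) U)
        ∂(wilsonMeasure r.ρ (sch.β (φ k)) : Measure (GaugeConfig 4 (2 * sch.L (φ k) + 1) G))), ← integral_complex_ofReal]
      congr 1
      refine integral_congr_ae (ae_of_all _ fun U => ?_)
      dsimp only
      rw [hconj, Complex.ofReal_mul, e1, e1]
    have hE1 : (∫ U, fieldObs r (sch.L (φ k)) (sch.a (φ k))
          ((((sch.c r.curvature (φ k) * sch.a (φ k) ^ 4) ^ n : ℝ) : ℂ) • F) (fun _ => sch.m r.curvature (φ k) / 6) U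
          ∂(wilsonMeasure r.ρ (sch.β (φ k)) : Measure (GaugeConfig 4 (2 * sch.L (φ k) + 1) G))).re =
        ∫ U, Y k (torusLift (2 * sch.L (φ k) + 1) U)
        ∂(wilsonMeasure r.ρ (sch.β (φ k)) : Measure (GaugeConfig 4 (2 * sch.L (φ k) + 1) G)) := by
      rw [← Complex.ofReal_re (∫ U, Y k (torusLift (2 * sch.L (φ k) + 1) U)
        ∂(wilsonMeasure r.ρ (sch.β (φ k)) : Measure (GaugeConfig 4 (2 * sch.L (φ k) + 1) G))), ← integral_complex_ofReal]
      congr 1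
      refine integral_congr_ae (ae_of_all _ fun U => ?_)
      dsimp only
      rw [e1]
    rw [hE2, hE0, hE1]
    have h := (le_abs_self _).trans habs
    linarith
  -- limits of the two sides of the lattice inequality
  have hA2 := (Complex.continuous_re.tendsto _).comp hP2
  have hA0 := (Complex.continuous_re.tendsto _).comp hP0
  have hA1 := (Complex.continuous_re.tendsto _).comp hP1
  have hE : Tendsto (fun k => Real.exp (-(Δ * sch.a (φ k) * ((2 * jj k : ℕ) : ℝ)))) atTop (𝓝 (Real.exp (-(Δ * t)))) := by
    have h1 : Tendsto (fun k => -(Δ * (((2 * jj k : ℕ) : ℝ) * sch.a (φ k)))) atTop (𝓝 (-(Δ * t))) :=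
      (hcoef.const_mul Δ).neg
    refine ((Real.continuous_exp.tendsto _).comp h1).congr fun k => ?_
    simp only [Function.comp_apply]
    ring_nf
  have hTh : Tendsto (fun k => C * (K₁ * ((sch.a (φ k))⁻¹ ^ Qr) ^ n) ^ 2 *
      Real.exp (-(Δ * sch.a (φ k) * (sch.L (φ k) : ℝ)))) atTop (𝓝 0) := by
    have h := (thermal_bookkeeping_tendsto sch hpv Δ hΔ (2 * (Qr * n)) 0 (C * K₁ ^ 2)).comp hφ.tendsto_atTop
    refine h.congr fun k => ?_
    simp only [Function.comp_apply, pow_zero, mul_one]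
    ring
  have hlim := le_of_tendsto_of_tendsto (hA2.sub (hA1.pow 2)) ((hE.mul (hA0.sub (hA1.pow 2))).add hTh) hineq
  simp only [add_zero] at hlim
  -- the connected OS forms of the limit family
  have hσ : planeSum T n F = (((planeSum T n F).re : ℝ) : ℂ) := (Complex.conj_eq_iff_re.1 hreal).symm
  have hcs : (conj (planeSum T n F) * planeSum T n F).re = (planeSum T n F).re ^ 2 := by
    rw [hreal]
    conv_lhs => rw [hσ]
    rw [← Complex.ofReal_mul, Complex.ofReal_re]
    ring
  simp only [conn]
  rw [hherm, htrans, Complex.sub_re, Complex.sub_re, hcs]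
  nlinarith [hlim, Real.exp_pos (-(Δ * t))]

end Main2

/-- **`stub_decayOfRPSpectralLocal`** (registered stub of line `registered`, reshape 5, crux stmt-QuantumFields-15915) —
**LOCAL RP-spectral relative clustering on the lattice ⇒ exponential decay of the diagonal connected OS form of the limit**
(`Decay (planeSum T) Δ`): the twin of `stub_decayOfRPSpectral` (crux stmt-QuantumFields-16120, r10) with the RP-spectral
hypothesis restricted to the LOCAL functional class (slab functionals supported in a spatial box of half-side `R`,
`2(R+1) ≤ S₀`); by `decay_separated_local` on the dense class of real test functions compactly supported at separated
positive-time points, and continuity of the connected OS forms in the test function.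
-- adapted from Theorems/PencilRigidityWeakCouplingHypercubicLimitDecayOfRPSpectral.lean [folklore] -/
theorem stub_decayOfRPSpectralLocal :
    ∀ (G : Type) [Group G] [TopologicalSpace G] [IsTopologicalGroup G] [CompactSpace G]
      [MeasurableSpace G] [BorelSpace G] (r : LatticeRep G) (sch : SpeciesScheme (YMSpecies G))
      (φ : ℕ → ℕ) (hφ : StrictMono φ)
      (T : (n : ℕ) → (Fin n → Plane) → (𝓢((Fin n → EuclideanSpace ℝ (Fin 4)), ℂ) →L[ℂ] ℂ)) (Δ C : ℝ),
      0 < Δ → PolyVolume sch → PolyRenorm r sch → (∃ Cm : ℝ, ∀ k, |sch.m r.curvature k| ≤ Cm) →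
        UniformFunctionalBoundPlanes r sch → PlaneLimits r sch φ T →
        (∀ᶠ k in atTop, ∀ (S₀ T₀ n R : ℕ), sch.L k ≤ S₀ → 2 * (T₀ + n + 1) ≤ S₀ → 2 * (R + 1) ≤ S₀ →
        ∀ (Y : LGConfig 4 G → ℝ) (B : ℝ), Measurable Y → (∀ U, |Y U| ≤ B) →
          DependsOn Y {e : Literature.MathematicalPhysics.QuantumLattice.ZdEdge 4 |
            (1 ≤ e.1 0 ∧ e.1 0 + (if e.2 = 0 then 1 else 0) ≤ T₀) ∧ ∀ i : Fin 4, i ≠ 0 → |e.1 i| ≤ R} →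
          |(∫ U, Y (torusLift (2 * S₀ + 1) (GaugeConfig.timeReflect U)) *
                Y (configShift (-Pi.single 0 (n : ℤ)) (torusLift (2 * S₀ + 1) U))
              ∂(wilsonMeasure r.ρ (sch.β k) : Measure (GaugeConfig 4 (2 * S₀ + 1) G))) -
            (∫ U, Y (torusLift (2 * S₀ + 1) U)
              ∂(wilsonMeasure r.ρ (sch.β k) : Measure (GaugeConfig 4 (2 * S₀ + 1) G))) ^ 2| ≤
            Real.exp (-(Δ * sch.a k * n)) *
              ((∫ U, Y (torusLift (2 * S₀ + 1) (GaugeConfig.timeReflect U)) * Y (torusLift (2 * S₀ + 1) U)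
                  ∂(wilsonMeasure r.ρ (sch.β k) : Measure (GaugeConfig 4 (2 * S₀ + 1) G))) -
                (∫ U, Y (torusLift (2 * S₀ + 1) U)
                  ∂(wilsonMeasure r.ρ (sch.β k) : Measure (GaugeConfig 4 (2 * S₀ + 1) G))) ^ 2) +
            C * B ^ 2 * Real.exp (-(Δ * sch.a k * S₀))) →
        Decay (planeSum T) Δ := by
  intro G _ _ _ _ _ _ r sch φ hφ T Δ C hΔ hpv hpr hbm hUFB hPL hrp n F hFo hFp hFc hFr t ht
  obtain ⟨u, hu_c, hu_sep, hu_supp, hu_real, hu_lim⟩ := separatedDensity_of_isOffDiagonal n F hFo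
  have hreal := hu_real hFr
  -- each approximant satisfies the inequality
  have hkey : ∀ m, (conn (planeSum T) (u m) (translateMulti (EuclideanSpace.single (0 : Fin 4) t) (u m))).re ≤
      (conn (planeSum T) (u m) (u m)).re * Real.exp (-(Δ * t)) := by
    intro m
    obtain ⟨δ, hδ, hsep⟩ := hu_sep m
    have hpos : tsupport (u m : (Fin n → EuclideanSpace ℝ (Fin 4)) → ℂ) ⊆ {v | ∀ l, 0 < v l 0} :=
      fun v hv => hFp (hu_supp m hv)
    obtain ⟨τ, hτ, hFτ⟩ := exists_time_floor (hu_c m) hpos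
    obtain ⟨ρ, hρ, hFρ⟩ := exists_radius (hu_c m)
    exact decay_separated_local r sch φ hφ T hUFB hPL hτ hδ hρ hFρ hFτ hsep (hreal m) hpv hpr hbm hΔ hrp ht
  -- pass to the limit along the approximants
  have h1 := ((continuous_conn_translateMulti (planeSum T) n (EuclideanSpace.single (0 : Fin 4) t)).tendsto F).comp hu_lim
  have h2 := ((continuous_conn_self (planeSum T) n).tendsto F).comp hu_lim
  exact le_of_tendsto_of_tendsto ((Complex.continuous_re.tendsto _).comp h1)
    (((Complex.continuous_re.tendsto _).comp h2).mul_const _) (Eventually.of_forall hkey)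

end Summit.QuantumFields.YangMills.Theorems.ContinuumFromLatticeGap

end
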